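import Summits.ValiantsHypothesis.ValiantsHypothesis.Theorems.FifoMatchingNNDivisionHardLocatedRowsCeiling
import HarnessLib

/-!
# LOCATED ROWS — part 8/8 — §5c ★★ the CEILING of the TEMPLATE: no pure located block for ANY exact-tilted rows on a cube with a `U`-internal zero-diagonal generator

Theorems-side port (staged by val-idea-40 g5 for the desk's P-W6b hand; declaration texts VERBATIM, namespace `…Theorems.FifoMatching.LocatedRows`) of val-idea-40 g5's crux workfile `Cruxes/NNDivisionHard/LocatedRows.lean` REV 6 @501a8cbaa22f §5c (critic of record val-idea-crit-9 g2).

* `tight4_dot_zgen` — six-point tightness of a direction `w` at `S, S+k, S+l, S+m, S+k+l, S+k+m` kills `⟨w, E^s_{kl} − E^s_{km}⟩` (mixed second differences);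
* ★★ `no_pure_block_of_zgen` — rows `(a, W a)` (`a ⊆ U`, ARBITRARY tilt per row, exact rhs `1 + h_COR(W a)`), columns `(S ∪ b, jc b)` (`b ⊆ U`, ARBITRARY listed passenger index per column), `Disjoint S U`, any row bounds `mrow`: the exact-law slack block is NOT the pure unique-disjointness pattern `(1 − |a ∩ b|)²` as soon as the cube has a generator `E^s_{kl} − E^s_{km}` with `k, l, m ∈ U` — i.e. the hypothesis `hblock` of the block count `three_pow_le_of_block` (the template of every located certificate) is unattainable on `Z_mix`-shape cubes.

HONEST LABEL: helper rows for an OPEN crux (21181 `NNDivisionHard` OPEN; `ExactPencilLaw`, `allRows.Law`, COR-VIRTUAL OPEN). A theorem about the certificate TEMPLATE, not a rank₊ statement. VP ≠ VNP is NOT proved here or anywhere in this tree.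
-/

set_option autoImplicit false

-- the mandated summit-side namespace repeats a component by design (single-problem summit)
set_option linter.dupNamespace false

noncomputable section

open Matrix Finset
open scoped Pointwise

namespace Summit.ValiantsHypothesis.ValiantsHypothesis.Theorems.FifoMatching.LocatedRows

open Literature.Barriers.PneNP (HasEFOfSize three_pow_le_card_mul_two_pow_of_cover_univ)
open Literature.Combinatorics.Optimization.FixedSizePsdRank (Cube bvec flat vecOuter corPolytope flat_dotProduct_vecOuter
  flat_dotProduct_le_of_mem_corPolytope)
open Summit.ValiantsHypothesis.ValiantsHypothesis.Theorems.FifoMatching.XcDivision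
  (udInd udPt udRow udMat udInd_apply udInd_sq udInd_inter ud_data udRow_dotProduct_flat_diagonal flat_dotProduct_flat
    dot_le_of_mem_convexHull)
open Summit.ValiantsHypothesis.Theorems.NNDivisionHardNegative.CliqueRowBlind (sum_udInd_mem sum_udInd_univ)
open Summit.ValiantsHypothesis.ValiantsHypothesis.Theorems.FifoMatching.GridCorShadow (four_T_lt_two_pow)
open Summit.ValiantsHypothesis.Theorems.NNDivisionHardNegative.DiagTilted
  (qOff qOffMat qOff_eq hasEFOfSize_qOff udRow_dotProduct_qOff udInd_compl udInd_univ)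

section TemplateCeiling
variable {n : ℕ}

/-! ## §5c ★★ The ceiling of the TEMPLATE, typed: no PURE located block for ANY exact-tilted rows on such a cube

One level above §5b (which concerns ONE common direction `w`): let the rows be `(a, W_a)`, `a ⊆ U`, with an ARBITRARY tilt
`W_a` per row and the exact rhs `1 + h_COR(W_a)`, let the columns be `(S ∪ b, j_b)`, `b ⊆ U`, with an ARBITRARY listed passenger
index `j_b` per column (`S ∩ U = ∅`), and let `m_a` be any upper bound of row `a` over the listed passenger points.  If the
exact-law slack matrix carries the PURE unique-disjointness pattern `(1 − |a ∩ b|)²` on this block (the hypothesis `hblock` of the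
block count `three_pow_le_of_block`, i.e. the template of every certificate in this file), then (`no_pure_block_of_zgen`) the cube
has NO generator `E^s_{kl} − E^s_{km}` with `k, l, m ∈ U`: purity forces, entry by entry, `⟨W_a, x_{S∪b}⟩ = h_COR(W_a)` (so by the
four-point mixed differences `tight4_dot_zgen` every `W_a` is orthogonal to the `U`-internal generators) and `j_b` to maximise EVERY
row — and then the rows `{k,m}` / `{k,l}` flip as in §5b.  So for `Z_mix`-shape cubes a C′-certificate cannot be a pure located
block at a COORDINATE face: it must use a non-coordinate face of COR (38 g2 `ExactPencil.cor_add_zgenCube_decided`: the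
transversal face `ι₁(S) ∪ ι₂(Sᶜ)` works, with one common direction) or count junk-tolerantly. -/

/-- (i′) FOUR-POINT version of `tight_dot_zgen`: tightness of `w` at `S`, `S+k`, `S+l`, `S+m`, `S+k+l`, `S+k+m` already kills
`⟨w, E^s_{kl} − E^s_{km}⟩`. -/
theorem tight4_dot_zgen {S : Finset (Fin n)} {w : Fin (n * n) → ℝ} {k l m : Fin n}
    (hk : k ∉ S) (hl : l ∉ S) (hm : m ∉ S) (hkl : k ≠ l) (hkm : k ≠ m)
    (hK : w ⬝ᵥ udPt (insert k S) = w ⬝ᵥ udPt S) (hL : w ⬝ᵥ udPt (insert l S) = w ⬝ᵥ udPt S)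
    (hM : w ⬝ᵥ udPt (insert m S) = w ⬝ᵥ udPt S)
    (hKL : w ⬝ᵥ udPt (insert k (insert l S)) = w ⬝ᵥ udPt S)
    (hKM : w ⬝ᵥ udPt (insert k (insert m S)) = w ⬝ᵥ udPt S) :
    w ⬝ᵥ flat (zgen k l m) = 0 := by
  classical
  have hval : ∀ b : Finset (Fin n), w ⬝ᵥ udPt b = ∑ p ∈ b, ∑ q ∈ b, unflat w p q := fun b => by
    rw [← flat_dotProduct_udPt_eq, flat_unflat]
  simp only [hval] at hK hL hM hKL hKM
  have h1 := mixed_diff (unflat w) hk hl hkl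
  have h2 := mixed_diff (unflat w) hk hm hkm
  rw [hKL, hK, hL] at h1
  rw [hKM, hK, hM] at h2
  rw [← flat_unflat w, flat_dotProduct_flat_zgen _ hkl hkm]
  linarith

/-- ★★ **NO PURE LOCATED BLOCK ON A CUBE WITH A `U`-INTERNAL ZERO-DIAGONAL GENERATOR — for ANY exact-tilted rows.**  Rows
`(a, W a)` (`a ⊆ U`, arbitrary tilts, exact rhs `1 + h_COR(W a)`), columns `(S ∪ b, jc b)` (`b ⊆ U`, arbitrary listed passenger index
per column), `Disjoint S U`, `mrow a` any upper bound of row `a` on the listed cube vertices (`e` surjective): the exact-law slack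
`(1 + h_COR(W a) + mrow a) − ⟨udRow a + W a, x_{S∪b} + q_{jc b}⟩` is NOT the pure pattern `(1 − |a∩b|)²` on the block, as soon as
some generator is `E^s_{kl} − E^s_{km}` with `k, l, m ∈ U` distinct. -/
theorem no_pure_block_of_zgen {N K : ℕ} (Q₀ : Matrix (Fin n) (Fin n) ℝ) (G : Fin N → Matrix (Fin n) (Fin n) ℝ)
    (e : Fin (K + 1) → Finset (Fin N)) (he : Function.Surjective e) (S U : Finset (Fin n)) (hSU : Disjoint S U)
    {t : Fin N} {k l m : Fin n} (hk : k ∈ U) (hl : l ∈ U) (hm : m ∈ U) (hkl : k ≠ l) (hkm : k ≠ m) (hlm : l ≠ m)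
    (hG : G t = zgen k l m)
    (W : Finset (Fin n) → Matrix (Fin n) (Fin n) ℝ) (jc : Finset (Fin n) → Fin (K + 1)) (mrow : Finset (Fin n) → ℝ)
    (hmq : ∀ a j, (udRow a + flat (W a)) ⬝ᵥ cubePt Q₀ G (e j) ≤ mrow a) :
    ¬ ∀ a, a ⊆ U → ∀ b, b ⊆ U →
        (1 + hCOR (W a) + mrow a) - (udRow a + flat (W a)) ⬝ᵥ (udPt (S ∪ b) + cubePt Q₀ G (e (jc b)))
          = (1 - ((a ∩ b).card : ℝ)) ^ 2 := by
  classical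
  intro hblock
  obtain ⟨-, -, slack, -⟩ := ud_data n
  have notS : ∀ {x : Fin n}, x ∈ U → x ∉ S := fun hx h => Finset.disjoint_left.1 hSU h hx
  -- purity ⇒ both nonnegative junk terms vanish entrywise
  have hdec : ∀ a, a ⊆ U → ∀ b, b ⊆ U →
      flat (W a) ⬝ᵥ udPt (S ∪ b) = hCOR (W a) ∧ (udRow a + flat (W a)) ⬝ᵥ cubePt Q₀ G (e (jc b)) = mrow a := by
    intro a ha b hb
    have h := hblock a ha b hb
    have hab : a ∩ (S ∪ b) = a ∩ b := by
      ext x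
      simp only [Finset.mem_inter, Finset.mem_union]
      constructor
      · rintro ⟨hx, hx' | hx'⟩
        · exact absurd hx' (notS (ha hx))
        · exact ⟨hx, hx'⟩
      · rintro ⟨hx, hx'⟩
        exact ⟨hx, Or.inr hx'⟩
    have hs := slack a (S ∪ b)
    rw [hab] at hs
    have hA := le_hCOR (W a) (S ∪ b)
    have hJ := hmq a (jc b)
    rw [dotProduct_add, add_dotProduct (udRow a) (flat (W a)) (udPt (S ∪ b))] at h
    constructor <;> linarith
  -- every row's tilt is tight at the four/five points ⇒ orthogonal to the generator
  have pairU : ∀ {x y : Fin n}, x ∈ U → y ∈ U → ({x, y} : Finset (Fin n)) ⊆ U := fun hx hy =>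
    Finset.insert_subset_iff.2 ⟨hx, Finset.singleton_subset_iff.2 hy⟩
  have singU : ∀ {x : Fin n}, x ∈ U → ({x} : Finset (Fin n)) ⊆ U := fun hx => Finset.singleton_subset_iff.2 hx
  have hS1 : ∀ x : Fin n, S ∪ {x} = insert x S := fun x => by
    ext y; simp only [Finset.mem_union, Finset.mem_singleton, Finset.mem_insert]; tauto
  have hS2 : ∀ x y : Fin n, S ∪ {x, y} = insert x (insert y S) := fun x y => by
    ext z; simp only [Finset.mem_union, Finset.mem_singleton, Finset.mem_insert]; tauto
  have horth : ∀ a, a ⊆ U → flat (W a) ⬝ᵥ flat (G t) = 0 := by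
    intro a ha
    have h0 := (hdec a ha ∅ (Finset.empty_subset _)).1
    rw [Finset.union_empty] at h0
    have hT : ∀ b, b ⊆ U → flat (W a) ⬝ᵥ udPt (S ∪ b) = flat (W a) ⬝ᵥ udPt S := fun b hb => by
      rw [(hdec a ha b hb).1, h0]
    rw [hG]
    refine tight4_dot_zgen (notS hk) (notS hl) (notS hm) hkl hkm ?_ ?_ ?_ ?_ ?_
    · rw [← hS1]; exact hT _ (singU hk)
    · rw [← hS1]; exact hT _ (singU hl)
    · rw [← hS1]; exact hT _ (singU hm)
    · rw [← hS2]; exact hT _ (pairU hk hl)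
    · rw [← hS2]; exact hT _ (pairU hk hm)
  have hrow : ∀ a, a ⊆ U → (udRow a + flat (W a)) ⬝ᵥ flat (G t) = udRow a ⬝ᵥ flat (zgen k l m) := fun a ha => by
    rw [add_dotProduct, horth a ha, add_zero, hG]
  have hval : ∀ (ρ : Fin (n * n) → ℝ) (P : Finset (Fin N)), t ∉ P →
      ρ ⬝ᵥ cubePt Q₀ G (insert t P) = ρ ⬝ᵥ cubePt Q₀ G P + ρ ⬝ᵥ flat (G t) := fun ρ P ht => by
    rw [dotProduct_cubePt, dotProduct_cubePt, Finset.sum_insert ht]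
    ring
  -- the common maximiser `P⋆ = e (jc ∅)` of the rows `{k,m}` and `{k,l}` flips
  have hmaxat : ∀ a, a ⊆ U → (udRow a + flat (W a)) ⬝ᵥ cubePt Q₀ G (e (jc ∅)) = mrow a :=
    fun a ha => (hdec a ha ∅ (Finset.empty_subset _)).2
  by_cases ht : t ∈ e (jc ∅)
  · obtain ⟨j', hj'⟩ := he ((e (jc ∅)).erase t)
    have h1 := hmq {k, l} j'
    rw [hj'] at h1
    have h2 := hval (udRow {k, l} + flat (W {k, l})) ((e (jc ∅)).erase t) (Finset.notMem_erase t _)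
    rw [Finset.insert_erase ht, hrow _ (pairU hk hl), udRow_pair_dot_zgen_neg hkl hkm hlm, hmaxat _ (pairU hk hl)] at h2
    linarith
  · obtain ⟨j', hj'⟩ := he (insert t (e (jc ∅)))
    have h1 := hmq {k, m} j'
    rw [hj'] at h1
    have h2 := hval (udRow {k, m} + flat (W {k, m})) (e (jc ∅)) ht
    rw [hrow _ (pairU hk hm), udRow_pair_dot_zgen_pos hkl hkm hlm, hmaxat _ (pairU hk hm)] at h2
    linarith

end TemplateCeiling

end Summit.ValiantsHypothesis.ValiantsHypothesis.Theorems.FifoMatching.LocatedRows
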